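/-
Copyright: cell `langlands-arthur-audit` (papers/Langlands/langlands-arthur-audit), unit `pub-arthur-typer-g18`
(LEAN TYPER gen 18, planner-pub-arthur-typer-g18-0, 2026-08-19).  Staged for the tree under
`Literature/NumberTheory/Automorphic/Arthur2013/Leaves/` (LEAN-IN-TREE rule 2026-08-18); imports `Leaves.DescentLevisCensus`
(M58) and `Leaves.DescentLevisCensus7` (M62), both over `Leaves.DescentLevis` (M55).  Module map: M66.
-/
import Literature.NumberTheory.Automorphic.Arthur2013.Leaves.DescentLevisCensus
import Literature.NumberTheory.Automorphic.Arthur2013.Leaves.DescentLevisCensus7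

/-!
# Leaves · engine L (M55), IV: the type profile of the essentially open factors, kernel-computed (`d ≤ 7`; third case `n = 5`)

Companion of `Leaves/DescentLevis` (M55; sources, readings and the eight consistency checks there) and of its censuses
`Leaves/DescentLevisCensus` (M58: `census6`, the `15` essential data of `GL_6 θ_6`), `Leaves/DescentLevisCensus7` (M62:
`census7`, the `16` of `GL_7 θ_7`), M55 `levis_certified_le5` (the `2` of `d ≤ 5`) and M55 `levisO_capable_5` (third
case `SO_10 ⋊ θ̃`: the `8` open-capable data).  The censuses decide WHICH descended data consume an essentially open
identity of [W4] 3.6 for some admissible tag choice; this module records, by `decide +kernel` over the same engine, WHAT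
is consumed there: for every one of the `33 + 8` data and every tag choice, the Cartan types of `Ḡ_{SC}`, `M̄_{sc}`,
`R̄_{sc}` (M55 `LResult.gTypes/mTypes/rTypes`), and for every invoked Levi subgroup `L̄ ∈ L^Ḡ(R̄)` with
`d^{G̃}_{R̄}(M̃, L̄) ≠ 0` carrying an essentially open factor (M55 `FlatInfo.essOpen`), the types of `L̄_der` and, per
essentially open factor (M55 `CompInfo.essOpen`), its type and its five flags `(weighted, ntriv, qns, res, hns)` (M55
`CompInfo`) — `DRow.tagProfile`, `ODRow.tagProfile`; tables `profile_le5`, `profile_6`, `profile_7`, `profileO_5`.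

READ OFF THE TABLES (theorems `kinds_le7`, `kinds_O5`, `count_le7`, `count_O5`, and in `Prop` form
`essOpen_factor_le7`, `essOpen_factor_O5`): (1) cases 1–2, `d ≤ 7`: every essentially open factor, at every tag
choice of every essential datum, is a SPLIT simple factor of type `C_2`, `C_3` or `D_3` (`sp_4`, `sp_6`, `so_6`:
flags `qns = res = false`), weighted, of non-trivial endoscopic datum, and non-split ONLY THROUGH `H̄` (`hns = true`:
the factor meets a tagged cell `so(2q)^δ` of `H̄`, `δ` the unramified quadratic character) — « kind (α) » of the
cell documentation; each essentially open tag choice invokes exactly ONE such `L̄` with exactly ONE such factor, and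
there are `42` essentially open tag choices on the `33` data (`2 + 21 + 19` at `d ≤ 5`, `d = 6`, `d = 7`); the
invoked `L̄_der` is `Sp_4`, `Sp_6`, `SO_6` or `Sp_4 × SL_2`, always with `L̄ ⊋ R̄` (types of `R̄_der` at these tag
choices: `A_1`, `A_1 × A_1` or `C_2`).  (2) third case, `n = 5`: every essentially open factor is of type `A_3` with flags `(true, true,
true, false, true)`: a QUASI-SPLIT NON-SPLIT factor (`qns = true`; `Ḡ_{SC} = SU(4)`, M52 `witnessU`'s mechanism: a
Frobenius-inverted class of multiplicity `4`), invoked as `L̄ = Ḡ` over `R̄_der` of type `A_1` — « kind (β) »; `8`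
essentially open tag choices on the `8` data, one factor each.  No factor of kind (β) occurs in cases 1–2 at `d ≤ 7`
and none of kind (α) in the third case at `n = 5`.

WHY THE TWO KINDS ARE RECORDED (the cell's reading, M55 module docstring and `DTag.scope_of_essOpen`; this module adds
no reading).  The descended identity is the Lie-algebra identity of [W4] 3.6, supplied by [W4] Thm. 3.8 (iii) under
[W4]'s standing hypothesis that the groups are unramified; the printed local theorem of [CL II] is stated for SPLIT
data: « Soit $\Fq$ un corps fini à $q$ éléments et $G$ un groupe réductif connexe, défini et déployé sur $\Fq$. Soit
$T$ un sous-tore maximal de $G$ défini et déployé sur $\Fq$. » (`lfpII-arxiv.tex:L439`), the endoscopic group being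
« $M'$ le groupe sur $\Fq$ dual de $\Mc'$. Le tore $T$ s'identifie à un sous-tore maximal de $M'$ » (`L453`), with
the identity « J^G_{M',M}(Y)=\sum_{s'\in Z_{\Mc}/Z_{\Gc}} |Z_{\Gc_{s'}}/Z_{\Gc}|^{-1} S_{M'}^{G_{s'}}(Y) » (`L483`,
display formula of the « théorème »).  A factor of kind (α) is a split `l̄` whose endoscopic datum is non-split (through `H̄`); a factor of kind
(β) is a non-split `l̄`.  Whether either kind is covered by a printed statement is NOT decided here (cell docs GAPS
G-TY-17-5 (34), LEAVES §29c/§29g): the tables only make the consumer list exact in type.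

What is NOT claimed: anything beyond the listed data (`d ≤ 7` essential data of cases 1–2; the `8` open-capable data of
the third case at `n = 5`; the third case has no essential datum at `n ≤ 4`, M58 `levisO4_blocks`, M60
`censusO4_holds`); that the lists are complete is M55/M58/M62's (`levis_certified_le5` — restated over the named list as
`essentialLe5_census` —, M58 `census6` and M62 `census7`, used BY NAME from the imported modules), not re-proved; no
status word of the cell's leaf census changes.
-/

set_option autoImplicit false

namespace Literature.NumberTheory.Automorphic.Arthur2013.Leaves

open NonStd BasePoint Diagram ODiagram

namespace LeviSet

/-! ## 1. The essential data, by name -/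

/-- the essential data of cases 1–2 at `d ≤ 5` (M55 `levis_certified_le5`): `GL_4 θ ⊃ GL_1 × GL_2 × GL_1`, `d⁻ = 2`,
`y = (1, 1)`, and `GL_5 θ ⊃ GL_1 × GL_3 × GL_1`, `d⁻ = 3`, `y = (-1, -1)` (M52 `witnessOdd`). [folklore] (data list) -/
def essentialLe5 : List (Row × Config) := [(⟨4, [1], 2, 2⟩, [.one, .one]), (⟨5, [1], 3, 3⟩, [.negOne, .negOne])]

/-- `essentialLe5` is M55's census of `2 ≤ d ≤ 5` (restatement of `levis_certified_le5`). [folklore] (by M55) -/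
theorem essentialLe5_census :
    certify ((List.range 4).flatMap (fun i => dRowsFor (i + 2))) = essentialLe5.map (fun p => (p.1, p.2, true)) :=
  levis_certified_le5

/-! ## 2. The profile of a datum -/

/-- the five flags of a factor, in the order `(weighted, ntriv, qns, res, hns)` of M55 `CompInfo`.
[folklore] (executable bookkeeping) -/
def CompInfo.flags (c : CompInfo) : List Bool := [c.weighted, c.ntriv, c.qns, c.res, c.hns]

/-- flags of « kind (α) »: weighted, non-trivial datum, split (`qns = res = false`), non-split through `H̄`.
[folklore] (cell documentation LEAVES §29c, as data) -/
def alphaFlags : List Bool := [true, true, false, false, true]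

/-- flags of « kind (β) »: weighted, non-trivial datum, quasi-split non-split factor (`qns = true`), `res = false`,
meeting a tagged cell. [folklore] (cell documentation LEAVES §29c, as data) -/
def betaFlags : List Bool := [true, true, true, false, true]

/-- an invoked `L̄` carrying an essentially open factor: (types of `L̄_der`, its essentially open factors as (type,
flags)). [folklore] (type abbreviation) -/
abbrev EssEntry : Type := List CompType × List (CompType × List Bool)

/-- (types of `Ḡ_{SC}`, of `M̄`, of `R̄`). [folklore] (type abbreviation) -/
abbrev TypeTriple : Type := List CompType × List CompType × List CompType

/-- a profile: the distinct type triples over the tag choices, and per tag choice the list of `EssEntry`.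
[folklore] (type abbreviation) -/
abbrev Profile : Type := List TypeTriple × List (List EssEntry)

/-- decidable equality of entries, assembled by hand (the nested products exceed the default instance search).
[folklore] (instance) -/
instance instDecidableEqEssEntry : DecidableEq EssEntry :=
  @instDecidableEqProd (List CompType) (List (CompType × List Bool)) inferInstance inferInstance

/-- decidable equality of type triples. [folklore] (instance) -/
instance instDecidableEqTypeTriple : DecidableEq TypeTriple :=
  @instDecidableEqProd (List CompType) (List CompType × List CompType) inferInstance inferInstance

/-- decidable equality of profiles, assembled by hand. [folklore] (instance) -/
instance instDecidableEqProfile : DecidableEq Profile :=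
  @instDecidableEqProd (List TypeTriple) (List (List EssEntry))
    (@instDecidableEqList TypeTriple instDecidableEqTypeTriple)
    (@instDecidableEqList (List EssEntry) (@instDecidableEqList EssEntry instDecidableEqEssEntry))

/-- per analysis: the invoked `L̄` (those with `d^{G̃}_{R̄}(M̃, L̄) ≠ 0`) carrying an essentially open factor, each as
(types of `L̄_der`, its essentially open factors as (type, flags)). [folklore] (executable bookkeeping) -/
def LResult.essProfile (R : LResult) : List EssEntry :=
  (R.invoked.filter FlatInfo.essOpen).map (fun f => (f.levi, (f.comps.filter CompInfo.essOpen).map (fun c => (c.type, c.flags))))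

/-- **profile of a descended datum of cases 1–2**: the distinct triples (types of `Ḡ_{SC}`, of `M̄`, of `R̄`) met over
its admissible tag choices (M55 `tagsOf`), and, tag choice by tag choice in M55's order, `LResult.essProfile`.
[folklore] (executable bookkeeping) -/
def DRow.tagProfile (x : DRow) : Profile :=
  (dedupD ((tagsOf x).map (fun i => (i.result.gTypes, i.result.mTypes, i.result.rTypes))),
    (tagsOf x).map (fun i => i.result.essProfile))

/-- **profile of a descended datum of the third case** (M55 `oTagsOf`, `OTag.result`), same shape.
[folklore] (executable bookkeeping) -/
def ODRow.tagProfile (x : ODRow) : Profile :=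
  (dedupD ((oTagsOf x).map (fun i => ((OTag.result i).gTypes, (OTag.result i).mTypes, (OTag.result i).rTypes))),
    (oTagsOf x).map (fun i => (OTag.result i).essProfile))

/-- table abbreviation: one invoked `L̄` of types `L` with one essentially open factor of type `t` and flags `fl`.
[folklore] (notation) -/
def one (L : List CompType) (t : CompType) (fl : List Bool) : List EssEntry := [(L, [(t, fl)])]

/-! ## 3. The tables (kernel evaluation) -/

/-- **`d ≤ 5`**: at both data `Ḡ_{SC} = Sp_4`, `M̄_der = SL_2`; the untagged choice has `R̄_der` trivial and consumes
nothing essentially open, the tagged one has `R̄_der = SL_2` and invokes `L̄ = Ḡ = Sp_4` with its one factor of kind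
(α). [folklore] (kernel evaluation) -/
theorem profile_le5 :
    essentialLe5.map (fun p => DRow.tagProfile ⟨p.1, p.2⟩) =
      [([([⟨.C, 2⟩], [⟨.A, 1⟩], []), ([⟨.C, 2⟩], [⟨.A, 1⟩], [⟨.A, 1⟩])], [[], one [⟨.C, 2⟩] ⟨.C, 2⟩ alphaFlags]),
       ([([⟨.C, 2⟩], [⟨.A, 1⟩], []), ([⟨.C, 2⟩], [⟨.A, 1⟩], [⟨.A, 1⟩])], [[], one [⟨.C, 2⟩] ⟨.C, 2⟩ alphaFlags])] := by
  decide +kernel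

/-- **`d = 6`** (the `15` data of M58 `essential6`, in its order; `44` tag choices): `Ḡ_{SC}` of type `C_3`, `C_2`
or `D_3`; every essentially open factor is of kind (α), of type `C_3`, `C_2` or `D_3`, one per essentially open tag
choice (`21` of them). [folklore] (kernel evaluation) -/
theorem profile_6 :
    essential6.map (fun p => DRow.tagProfile ⟨p.1, p.2⟩) =
      [([([⟨.C, 3⟩], [⟨.C, 2⟩], [⟨.A, 1⟩]), ([⟨.C, 3⟩], [⟨.C, 2⟩], [⟨.C, 2⟩])],
          [[], one [⟨.C, 3⟩] ⟨.C, 3⟩ alphaFlags]),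
       ([([⟨.C, 2⟩], [⟨.A, 1⟩], []), ([⟨.C, 2⟩], [⟨.A, 1⟩], [⟨.A, 1⟩])],
          [[], one [⟨.C, 2⟩] ⟨.C, 2⟩ alphaFlags, [], one [⟨.C, 2⟩] ⟨.C, 2⟩ alphaFlags]),
       ([([⟨.C, 2⟩], [⟨.A, 1⟩], []), ([⟨.C, 2⟩], [⟨.A, 1⟩], [⟨.A, 1⟩])],
          [[], one [⟨.C, 2⟩] ⟨.C, 2⟩ alphaFlags, [], one [⟨.C, 2⟩] ⟨.C, 2⟩ alphaFlags]),
       ([([⟨.D, 3⟩], [⟨.A, 1⟩, ⟨.A, 1⟩], []), ([⟨.D, 3⟩], [⟨.A, 1⟩, ⟨.A, 1⟩], [⟨.A, 1⟩, ⟨.A, 1⟩])],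
          [[], [], [], one [⟨.D, 3⟩] ⟨.D, 3⟩ alphaFlags]),
       ([([⟨.C, 3⟩], [⟨.C, 2⟩], [⟨.C, 2⟩])],
          [[], one [⟨.C, 3⟩] ⟨.C, 3⟩ alphaFlags]),
       ([([⟨.C, 2⟩], [⟨.A, 1⟩], []), ([⟨.C, 2⟩], [⟨.A, 1⟩], [⟨.A, 1⟩])],
          [[], one [⟨.C, 2⟩] ⟨.C, 2⟩ alphaFlags, [], one [⟨.C, 2⟩] ⟨.C, 2⟩ alphaFlags]),
       ([([⟨.C, 2⟩], [⟨.A, 1⟩], []), ([⟨.C, 2⟩], [⟨.A, 1⟩], [⟨.A, 1⟩])],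
          [[], one [⟨.C, 2⟩] ⟨.C, 2⟩ alphaFlags, [], one [⟨.C, 2⟩] ⟨.C, 2⟩ alphaFlags]),
       ([([⟨.C, 2⟩], [⟨.A, 1⟩], []), ([⟨.C, 2⟩], [⟨.A, 1⟩], [⟨.A, 1⟩])],
          [[], [], one [⟨.C, 2⟩] ⟨.C, 2⟩ alphaFlags, one [⟨.C, 2⟩] ⟨.C, 2⟩ alphaFlags]),
       ([([⟨.C, 2⟩], [⟨.A, 1⟩], []), ([⟨.C, 2⟩], [⟨.A, 1⟩], [⟨.A, 1⟩])],
          [[], one [⟨.C, 2⟩] ⟨.C, 2⟩ alphaFlags, [], one [⟨.C, 2⟩] ⟨.C, 2⟩ alphaFlags]),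
       ([([⟨.C, 3⟩], [⟨.A, 1⟩, ⟨.A, 1⟩], [⟨.A, 1⟩]), ([⟨.C, 3⟩], [⟨.A, 1⟩, ⟨.A, 1⟩], [⟨.A, 1⟩, ⟨.A, 1⟩])],
          [[], one [⟨.C, 3⟩] ⟨.C, 3⟩ alphaFlags]),
       ([([⟨.C, 2⟩], [⟨.A, 1⟩], []), ([⟨.C, 2⟩], [⟨.A, 1⟩], [⟨.A, 1⟩])],
          [[], one [⟨.C, 2⟩] ⟨.C, 2⟩ alphaFlags]),
       ([([⟨.C, 2⟩], [⟨.A, 1⟩], []), ([⟨.C, 2⟩], [⟨.A, 1⟩], [⟨.A, 1⟩])],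
          [[], one [⟨.C, 2⟩] ⟨.C, 2⟩ alphaFlags]),
       ([([⟨.C, 2⟩], [⟨.A, 1⟩], []), ([⟨.C, 2⟩], [⟨.A, 1⟩], [⟨.A, 1⟩])],
          [[], one [⟨.C, 2⟩] ⟨.C, 2⟩ alphaFlags]),
       ([([⟨.C, 2⟩], [⟨.A, 1⟩], []), ([⟨.C, 2⟩], [⟨.A, 1⟩], [⟨.A, 1⟩])],
          [[], one [⟨.C, 2⟩] ⟨.C, 2⟩ alphaFlags]),
       ([([⟨.C, 3⟩], [⟨.A, 1⟩], []), ([⟨.C, 3⟩], [⟨.A, 1⟩], [⟨.A, 1⟩])],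
          [[], one [⟨.C, 3⟩] ⟨.C, 3⟩ alphaFlags])] := by
  decide +kernel

/-- **`d = 7`** (the `16` data of M62 `essential7`, in its order; `38` tag choices): `Ḡ_{SC}` of type `C_2 × A_1`,
`C_3` or `C_2`; every essentially open factor is of kind (α), of type `C_2` or `C_3`, one per essentially open tag
choice (`19` of them); the invoked `L̄_der` is `Sp_4 × SL_2`, `Sp_6` or `Sp_4`. [folklore] (kernel evaluation) -/
theorem profile_7 :
    essential7.map (fun p => DRow.tagProfile ⟨p.1, p.2⟩) =
      [([([⟨.C, 2⟩, ⟨.A, 1⟩], [⟨.A, 1⟩, ⟨.A, 1⟩], [⟨.A, 1⟩]), ([⟨.C, 2⟩, ⟨.A, 1⟩], [⟨.A, 1⟩, ⟨.A, 1⟩], [⟨.A, 1⟩, ⟨.A, 1⟩])],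
          [[], one [⟨.C, 2⟩, ⟨.A, 1⟩] ⟨.C, 2⟩ alphaFlags]),
       ([([⟨.C, 3⟩], [⟨.C, 2⟩], [⟨.A, 1⟩]), ([⟨.C, 3⟩], [⟨.C, 2⟩], [⟨.C, 2⟩])],
          [[], one [⟨.C, 3⟩] ⟨.C, 3⟩ alphaFlags]),
       ([([⟨.C, 2⟩], [⟨.A, 1⟩], []), ([⟨.C, 2⟩], [⟨.A, 1⟩], [⟨.A, 1⟩])],
          [[], one [⟨.C, 2⟩] ⟨.C, 2⟩ alphaFlags, [], one [⟨.C, 2⟩] ⟨.C, 2⟩ alphaFlags]),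
       ([([⟨.C, 2⟩, ⟨.A, 1⟩], [⟨.A, 1⟩, ⟨.A, 1⟩], [⟨.A, 1⟩]), ([⟨.C, 2⟩, ⟨.A, 1⟩], [⟨.A, 1⟩, ⟨.A, 1⟩], [⟨.A, 1⟩, ⟨.A, 1⟩])],
          [[], one [⟨.C, 2⟩, ⟨.A, 1⟩] ⟨.C, 2⟩ alphaFlags]),
       ([([⟨.C, 2⟩, ⟨.A, 1⟩], [⟨.A, 1⟩, ⟨.A, 1⟩], [⟨.A, 1⟩]), ([⟨.C, 2⟩, ⟨.A, 1⟩], [⟨.A, 1⟩, ⟨.A, 1⟩], [⟨.A, 1⟩, ⟨.A, 1⟩])],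
          [[], one [⟨.C, 2⟩, ⟨.A, 1⟩] ⟨.C, 2⟩ alphaFlags]),
       ([([⟨.C, 3⟩], [⟨.C, 2⟩], [⟨.C, 2⟩])],
          [[], one [⟨.C, 3⟩] ⟨.C, 3⟩ alphaFlags]),
       ([([⟨.C, 2⟩], [⟨.A, 1⟩], []), ([⟨.C, 2⟩], [⟨.A, 1⟩], [⟨.A, 1⟩])],
          [[], one [⟨.C, 2⟩] ⟨.C, 2⟩ alphaFlags, [], one [⟨.C, 2⟩] ⟨.C, 2⟩ alphaFlags]),
       ([([⟨.C, 2⟩], [⟨.A, 1⟩], []), ([⟨.C, 2⟩], [⟨.A, 1⟩], [⟨.A, 1⟩])],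
          [[], one [⟨.C, 2⟩] ⟨.C, 2⟩ alphaFlags, [], one [⟨.C, 2⟩] ⟨.C, 2⟩ alphaFlags]),
       ([([⟨.C, 2⟩, ⟨.A, 1⟩], [⟨.A, 1⟩], []), ([⟨.C, 2⟩, ⟨.A, 1⟩], [⟨.A, 1⟩], [⟨.A, 1⟩])],
          [[], one [⟨.C, 2⟩] ⟨.C, 2⟩ alphaFlags]),
       ([([⟨.C, 2⟩, ⟨.A, 1⟩], [⟨.A, 1⟩], []), ([⟨.C, 2⟩, ⟨.A, 1⟩], [⟨.A, 1⟩], [⟨.A, 1⟩])],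
          [[], one [⟨.C, 2⟩] ⟨.C, 2⟩ alphaFlags]),
       ([([⟨.C, 3⟩], [⟨.A, 1⟩, ⟨.A, 1⟩], [⟨.A, 1⟩]), ([⟨.C, 3⟩], [⟨.A, 1⟩, ⟨.A, 1⟩], [⟨.A, 1⟩, ⟨.A, 1⟩])],
          [[], one [⟨.C, 3⟩] ⟨.C, 3⟩ alphaFlags]),
       ([([⟨.C, 2⟩], [⟨.A, 1⟩], []), ([⟨.C, 2⟩], [⟨.A, 1⟩], [⟨.A, 1⟩])],
          [[], one [⟨.C, 2⟩] ⟨.C, 2⟩ alphaFlags]),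
       ([([⟨.C, 2⟩], [⟨.A, 1⟩], []), ([⟨.C, 2⟩], [⟨.A, 1⟩], [⟨.A, 1⟩])],
          [[], one [⟨.C, 2⟩] ⟨.C, 2⟩ alphaFlags]),
       ([([⟨.C, 2⟩, ⟨.A, 1⟩], [⟨.A, 1⟩], []), ([⟨.C, 2⟩, ⟨.A, 1⟩], [⟨.A, 1⟩], [⟨.A, 1⟩])],
          [[], one [⟨.C, 2⟩, ⟨.A, 1⟩] ⟨.C, 2⟩ alphaFlags]),
       ([([⟨.C, 2⟩, ⟨.A, 1⟩], [⟨.A, 1⟩], []), ([⟨.C, 2⟩, ⟨.A, 1⟩], [⟨.A, 1⟩], [⟨.A, 1⟩])],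
          [[], one [⟨.C, 2⟩, ⟨.A, 1⟩] ⟨.C, 2⟩ alphaFlags]),
       ([([⟨.C, 3⟩], [⟨.A, 1⟩], []), ([⟨.C, 3⟩], [⟨.A, 1⟩], [⟨.A, 1⟩])],
          [[], one [⟨.C, 3⟩] ⟨.C, 3⟩ alphaFlags])] := by
  decide +kernel

/-- **third case, `n = 5`** (the `8` data of M55 `capable5`; `16` tag choices): `Ḡ_{SC}` of type `A_3`, `M̄_der`
of type `A_1`; the choice inverting no class consumes nothing essentially open, the choice inverting the class invokes
`L̄ = Ḡ` (type `A_3`) over `R̄_der` of type `A_1` with its one factor of kind (β). [folklore] (kernel evaluation) -/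
theorem profileO_5 :
    capable5.map ODRow.tagProfile =
      List.replicate 8 ([([⟨.A, 3⟩], [⟨.A, 1⟩], []), ([⟨.A, 3⟩], [⟨.A, 1⟩], [⟨.A, 1⟩])],
        [[], one [⟨.A, 3⟩] ⟨.A, 3⟩ betaFlags]) := by
  decide +kernel

/-! ## 4. Read off the tables (no further engine evaluation) -/

/-- kind (α) test on a (type, flags) pair. [folklore] (executable bookkeeping) -/
def kindAlpha (q : CompType × List Bool) : Bool :=
  decide (q.1 ∈ [(⟨.C, 2⟩ : CompType), ⟨.C, 3⟩, ⟨.D, 3⟩]) && q.2 == alphaFlags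

/-- kind (β) test on a (type, flags) pair. [folklore] (executable bookkeeping) -/
def kindBeta (q : CompType × List Bool) : Bool :=
  decide (q.1 = (⟨.A, 3⟩ : CompType)) && q.2 == betaFlags

/-- uniform shape of a profile: every tag choice invokes at most one `L̄` with an essentially open factor, that `L̄`
has exactly one, and every essentially open factor passes the test `k`. [folklore] (executable bookkeeping) -/
def profileShape (k : CompType × List Bool → Bool) (P : Profile) : Bool :=
  P.2.all (fun tag => decide (tag.length ≤ 1) && tag.all (fun e => (e.2.length == 1) && e.2.all k))

/-- number of tag choices of a profile consuming an essentially open identity. [folklore] (executable bookkeeping) -/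
def profileCount (P : Profile) : Nat :=
  (P.2.filter (fun tag => !tag.isEmpty)).length

/-- **cases 1–2, `d ≤ 7`: kind (α) only, one `L̄`, one factor.** [folklore] (read off `profile_le5/6/7`) -/
theorem kinds_le7 :
    ((essentialLe5 ++ essential6 ++ essential7).map (fun p => DRow.tagProfile ⟨p.1, p.2⟩)).all (profileShape kindAlpha) =
      true := by
  rw [List.map_append, List.map_append, profile_le5, profile_6, profile_7]; decide +kernel

/-- **third case, `n = 5`: kind (β) only, one `L̄`, one factor.** [folklore] (read off `profileO_5`) -/
theorem kinds_O5 : (capable5.map ODRow.tagProfile).all (profileShape kindBeta) = true := by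
  rw [profileO_5]; decide +kernel

/-- **`42` essentially open tag choices at `d ≤ 7`** (`2 + 21 + 19` at `d ≤ 5`, `d = 6`, `d = 7`).
[folklore] (read off `profile_le5/6/7`) -/
theorem count_le7 :
    (((essentialLe5 ++ essential6 ++ essential7).map (fun p => DRow.tagProfile ⟨p.1, p.2⟩)).map profileCount).sum = 42 ∧
    ((essentialLe5.map (fun p => DRow.tagProfile ⟨p.1, p.2⟩)).map profileCount).sum = 2 ∧
    ((essential6.map (fun p => DRow.tagProfile ⟨p.1, p.2⟩)).map profileCount).sum = 21 ∧
    ((essential7.map (fun p => DRow.tagProfile ⟨p.1, p.2⟩)).map profileCount).sum = 19 := by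
  rw [List.map_append, List.map_append, profile_le5, profile_6, profile_7]; decide +kernel

/-- **`8` essentially open tag choices in the third case at `n = 5`** (one per datum). [folklore] (read off `profileO_5`) -/
theorem count_O5 : ((capable5.map ODRow.tagProfile).map profileCount) = List.replicate 8 1 := by
  rw [profileO_5]; decide +kernel

/-- `profileCount` counts the essentially open tag choices: a tag choice's `essProfile` is empty iff its analysis is not
essentially open. [folklore] (bookkeeping lemma) -/
theorem LResult.essProfile_isEmpty (R : LResult) : R.essProfile.isEmpty = !R.essOpen := by
  unfold LResult.essProfile LResult.essOpen
  induction R.invoked with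
  | nil => rfl
  | cons f fs ih =>
    cases hf : f.essOpen
    · simp only [List.filter_cons, hf, List.any_cons, Bool.false_or]
      simpa using ih
    · simp [hf, List.any_cons]

/-- `profileCount` is the number of essentially open tag choices (cases 1–2). [folklore] (bookkeeping lemma) -/
theorem DRow.profileCount_eq (x : DRow) :
    profileCount (DRow.tagProfile x) = ((tagsOf x).filter (fun i => i.result.essOpen)).length := by
  unfold profileCount DRow.tagProfile
  simp only [List.filter_map, List.length_map, Function.comp_def, LResult.essProfile_isEmpty, Bool.not_not]

/-- `profileCount` is the number of essentially open tag choices (third case). [folklore] (bookkeeping lemma) -/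
theorem ODRow.profileCount_eq (x : ODRow) :
    profileCount (ODRow.tagProfile x) = ((oTagsOf x).filter (fun i => (OTag.result i).essOpen)).length := by
  unfold profileCount ODRow.tagProfile
  simp only [List.filter_map, List.length_map, Function.comp_def, LResult.essProfile_isEmpty, Bool.not_not]

/-- **the reading in `Prop` form, cases 1–2**: at every essential datum of `d ≤ 7`, every tag choice, every invoked
`L̄` carrying an essentially open factor and every essentially open factor of it: type `C_2`, `C_3` or `D_3`, weighted,
non-trivial datum, `qns = false`, `res = false`, `hns = true`. [folklore] (read off `kinds_le7`) -/
theorem essOpen_factor_le7 (p : Row × Config) (hp : p ∈ essentialLe5 ++ essential6 ++ essential7)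
    (i : DTag) (hi : i ∈ tagsOf ⟨p.1, p.2⟩) (f : FlatInfo) (hf : f ∈ i.result.invoked) (hfe : f.essOpen = true)
    (c : CompInfo) (hc : c ∈ f.comps) (hce : c.essOpen = true) :
    c.type ∈ [(⟨.C, 2⟩ : CompType), ⟨.C, 3⟩, ⟨.D, 3⟩] ∧ c.weighted = true ∧ c.ntriv = true ∧ c.qns = false ∧
      c.res = false ∧ c.hns = true := by
  have h := kinds_le7
  rw [List.all_eq_true] at h
  have hP := h _ (List.mem_map.2 ⟨p, hp, rfl⟩)
  unfold profileShape DRow.tagProfile at hP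
  simp only [List.all_eq_true, Bool.and_eq_true] at hP
  have hT := (hP _ (List.mem_map.2 ⟨i, hi, rfl⟩)).2 _
    (List.mem_map.2 ⟨f, List.mem_filter.2 ⟨hf, hfe⟩, rfl⟩)
  have hK := hT.2 _ (List.mem_map.2 ⟨c, List.mem_filter.2 ⟨hc, hce⟩, rfl⟩)
  unfold kindAlpha CompInfo.flags alphaFlags at hK
  simp only [Bool.and_eq_true, decide_eq_true_eq, beq_iff_eq, List.cons.injEq, and_true] at hK
  exact ⟨hK.1, hK.2.1, hK.2.2.1, hK.2.2.2.1, hK.2.2.2.2.1, hK.2.2.2.2.2⟩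

/-- **the reading in `Prop` form, third case `n = 5`**: every essentially open factor is of type `A_3`, weighted,
non-trivial datum, `qns = true`, `res = false`, `hns = true`. [folklore] (read off `kinds_O5`) -/
theorem essOpen_factor_O5 (x : ODRow) (hx : x ∈ capable5)
    (i : ODInst) (hi : i ∈ oTagsOf x) (f : FlatInfo) (hf : f ∈ (OTag.result i).invoked) (hfe : f.essOpen = true)
    (c : CompInfo) (hc : c ∈ f.comps) (hce : c.essOpen = true) :
    c.type = ⟨.A, 3⟩ ∧ c.weighted = true ∧ c.ntriv = true ∧ c.qns = true ∧ c.res = false ∧ c.hns = true := by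
  have h := kinds_O5
  rw [List.all_eq_true] at h
  have hP := h _ (List.mem_map.2 ⟨x, hx, rfl⟩)
  unfold profileShape ODRow.tagProfile at hP
  simp only [List.all_eq_true, Bool.and_eq_true] at hP
  have hT := (hP _ (List.mem_map.2 ⟨i, hi, rfl⟩)).2 _
    (List.mem_map.2 ⟨f, List.mem_filter.2 ⟨hf, hfe⟩, rfl⟩)
  have hK := hT.2 _ (List.mem_map.2 ⟨c, List.mem_filter.2 ⟨hc, hce⟩, rfl⟩)
  unfold kindBeta CompInfo.flags betaFlags at hK
  simp only [Bool.and_eq_true, decide_eq_true_eq, beq_iff_eq, List.cons.injEq, and_true] at hK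
  exact ⟨hK.1, hK.2.1, hK.2.2.1, hK.2.2.2.1, hK.2.2.2.2.1, hK.2.2.2.2.2⟩

end LeviSet

end Literature.NumberTheory.Automorphic.Arthur2013.Leaves
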